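/-
Copyright: lit-balaban Phase-2 proof seat p02 (gen 8).  Statement-level skeleton of a published paper; no proof claims beyond what
the kernel checks below.
-/
import Literature.MathematicalPhysics.QuantumFieldTheory.BalabanImbrieJaffe1984to88.BIJ88Decay216Prop12
import Literature.MathematicalPhysics.QuantumFieldTheory.BalabanImbrieJaffe1984to88.BIJ85Claim73ActualOne
import Literature.MathematicalPhysics.QuantumFieldTheory.BalabanImbrieJaffe1984to88.BIJ88Sect5StatementsPart2

/-!
# `BalabanImbrieJaffe1984to88.BIJ88Ineq555W3Torus` — T. Bałaban, J. Imbrie, A. Jaffe, *Effective action and cluster properties of the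
abelian Higgs model*, Commun. Math. Phys. **114** (1988) 257–315 [BalabanImbrieJaffe1988], §5.5 *Second Gauge Field Translation*,
p. 284 **(5.5.4)–(5.5.5)** — the small localized kernel `w′₃ = (σ_{k,loc} − σ_k)∂Λ₂^{(k)*}□` of (5.5.4) and the two printed facts about it,
*"The kernels w′₃, w″₃ have range less than ½r(e_k), and we have |w′₃(p,b)|, |w″₃(p,b)| ≦ e^{−cr(e_k)}. (5.5.5)"* — the `w′₃` HALF PROVED ON
THE TORI OF THE SERIES FOR THE `σ_k` OF RECORD (p30's `sigmaTorus` at the physical weights, `σ_{k,loc}` = r18's (2.14) truncation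
`trunc pdist R σ_k`, `∂` = the unit-lattice curl of `LatticeFieldCalculus`), given only [6I] Proposition 1.2 by its tree name: ONE
decay constant and ONE radius threshold for every scale `k ≤ m + K`; and the RANGE CLAUSE for `w′₃` as the support statement of the
cube family `□ = □(p)`

statement-level skeleton of published theorems with citation tags; proofs where landed; nothing here is a claim about the Yang–Mills mass gap

PDF held: `paper:balaban1988-cmp114-bij-abelian-higgs-effective-action` (journal page = PDF page + 256); p. 284 [PDF 28] read this
session from the text layer (`~/.lit/texts/paper-balaban1988-cmp114-bij-abelian-higgs-effective-action/p0028.txt`) and the r16 render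
`HOME/lit-balaban-r16/renders/cmp114/original-p028-x2.png`; p. 261–262 [PDF 5–6] ((2.14), (2.18)).

CITATION HEADER (lean-in-tree rule).  Part of the lit-balaban TYPED SKELETON (HOME `run/shared/lean/pub/lit-balaban/`), Phase-2 proof
seat p02 (gen 8), unit `lit-balaban-p02`; WHAT IS REPRODUCED = SKELETON row **C2.Eq5.5.5** (reader file `HOME/lit-balaban-r16/ROWS-C2-part2.md`,
owner r16, referee ref-5: *"typed p240155 (Prop leaf) · (5.5.5) proved p247796 (p36, model instance: `BIJ88Ineq555Proof.ineq555_matrix` for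
Part3's `wPrime3`/`wDoublePrime3` in `Matrix ι ι ℝ` … the range clause «range less than ½r(e_k)» stays typed)"*), kind «model instance FOR
THE KERNEL OF RECORD ON THE TORI» for the `w′₃` member: p36's one-index matrix instance takes (2.18) as a displayed hypothesis; here
`σ_k` IS the torus operator of record and (2.18) is DISCHARGED down to [6I] Proposition 1.2 (`B5.Prop12Printed`, row B5.Prop1.2 —
proved for the tori of record by p37 p302056; the bridge to the `levStd` torus family is the announced target of p19/p30) through p08
g8's `BIJ88Decay216Prop12.close218_torus_prop12`.  TAKING line HOME/STATUS.md 2026-08-21T21:09:53Z.  Decls used BY NAME (nothing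
restated): r18's `Close`/`trunc`, p30's `sigmaTorus`/`toU`, p08's `pdist`/`close218_torus_prop12`, p33's curl column count
`BIJ85Claim73ActualOne.sum_abs_curl_single_le`, r16's `Ineq555` (quoted in §3 only: it bundles BOTH kernels, and `w″₃` is not treated here).

THE PRINTED TEXT (p. 284 [PDF 28], verbatim): *"In the second term we isolate a term localized near Λ₅^{(k)c} and a small term. We write
𝒬′₂ = ⟨Λ₁^{(k)**}L⁻²Q^{e*}f, σ_{k,loc}Λ₁^{(k)**}∂Λ₂^{(k)*c}A^{(k)}⟩, and in the term with Λ₂^{(k)*} instead of Λ₂^{(k)*c} we put σ_{k,loc}∂Λ₂^{(k)*}A^{(k)}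
= σ_{k,loc}∂Λ₂^{(k)*}□A^{(k)} = σ_k∂Λ₂^{(k)*}□A^{(k)} + w′₃A^{(k)} = Q^e_k∂^ηH_kΛ₂^{(k)*}□A^{(k)} + w′₃A^{(k)} = Q^e_k∂^ηH_{k,loc}Λ₂^{(k)*}A^{(k)} + w″₃A^{(k)}.
(5.5.4) The ½r(e_k)-cube □ is centered near the plaquette that we are evaluating σ_{k,loc}∂Λ₂^{(k)*}A^{(k)} at. The kernels w′₃, w″₃ have
range less than ½r(e_k), and we have |w′₃(p,b)|, |w″₃(p,b)| ≦ e^{−cr(e_k)}. (5.5.5)"*; (2.14) p. 261: *"σ_{k,loc}(p₁,p₂) = σ_k(p₁,p₂) if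
dist(p₁,p₂) ≦ (1/2L)r(e_{k−1}), 0 otherwise"*; (2.18) p. 262: *"|σ_{k,loc}(p₁,p₂) − σ_k(p₁,p₂)| ≦ ce^{−cr(e_k)}e^{−c dist(p₁,p₂)}"*.

THE TORUS DATA (all in the tree, as in `BIJ88Decay216Prop12`): unit plaquettes `p ∈ T₁^{(k)} = TPlaq P k`, unit bonds `b ∈ PBond P k`;
the kernel of the σ_k of record at the physical weights, `σ_k(p, q) := (sigmaTorus hd η_k^d L^k k e_q)(p)`; `σ_{k,loc} := trunc pdist R σ_k`
((2.14) at the truncation radius `R`, print: `R = (1/2L)r(e_{k−1})`); `∂(p′, b) := curl c_∂ δ_b p′` — the unit-lattice curl of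
`LatticeFieldCalculus` applied to the indicator of the bond `b` (print: `c_∂ = 1` on `T₁^{(k)}`; any `|c_∂| ≤ 1` below); the region
`Λ₂^{(k)*}` as a contraction `χ₂ : PBond P k → ℝ`, `|χ₂| ≤ 1`, and the cube `□ = □(p)` as a family `χ□ : TPlaq P k → PBond P k → ℝ`,
`|χ□| ≤ 1`, read ROW-WISE exactly as in p36's matrix instance of record — so that
`w′₃(p, b) = (Σ_{p′} (σ_{k,loc} − σ_k)(p,p′)·∂(p′,b))·χ₂(b)·χ□_p(b)` is the `(p,b)` entry of `(σ_{k,loc} − σ_k)∂Λ₂^{(k)*}□` (r16's ring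
element `BIJ88Sect5StatementsPart3.wPrime3 σloc σ ∂ Λ₂ □ = (σloc − σ)·∂·Λ₂·□`, p36's `wPrime3_apply`).

WHAT IS PROVED (0 `sorry`, standard axioms; theorems only — proof lane):
* §1 MECHANISM (rectangular carriers `α` = plaquettes, `β` = bonds; p36's `abs_wPrime3_le` without the single-index restriction and
  WITHOUT a lattice-sum hypothesis — the bond-indicator column count replaces it): `w3p_entry` (notation), **`abs_w3p_le`**
  (`Close dist σ_{k,loc} σ_k ε δ`, `0 ≤ δ`, `Σ_{p′}|∂(p′,b)| ≤ S`, `|χ₂|, |χ□| ≤ 1` ⟹ `|w′₃(p,b)| ≤ εS`), **`w3p_eq_zero_of_box`** /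
  **`w3p_range`** (THE RANGE CLAUSE: `w′₃(p,b) = 0` off `□(p)`; hence if every `□(p)` lies within distance `ρ` of `p`, `w′₃(p,·)` has range
  `≤ ρ` — print's *"range less than ½r(e_k)"* with `ρ = ½r(e_k)`, the cube being *"centered near the plaquette"*), `small_of_le_mul`
  (the arithmetic of *"r(e_k) large"*).
* §2 ON THE TORI, GIVEN ONLY `B5.Prop12Printed` (`levStd` family): **`ineq555_w3prime_torus`** — `∃ c > 0, ∃ R₁, ∀ k ≤ m + K, ∀ R ≥ R₁,
  ∀ |c_∂| ≤ 1, ∀ χ₂, ∀ χ□: |w′₃(p,b)| ≤ e^{−cR}` for all `p, b`, for the torus kernel above (`c = δ′/4`, `R₁ = max(R₀, 16d·c₀/δ′)` in the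
  constants of p08's (2.18) `close218_torus_prop12`; the plaquette column count of a bond is p33's `sum_abs_curl_single_le`, `≤ 4d|c_∂|`);
  `ineq555_w3prime_torus_explicit` (the bound `4d·c₀e^{−(δ′/2)R}` before absorbing the constant); **`w3p_range_torus`** (the range
  clause on the tori: `w′₃(p,b) = 0` whenever `χ□_p(b) = 0`).
* §3 `ineq555_of_members` — r16's typed pair statement `Ineq555 Plaq Bond w′₃ w″₃ c r` from the two member bounds (bookkeeping; the `w″₃`
  member is NOT supplied by this file).
HONEST SCOPE.  (i) The one remaining hypothesis is [6I] Proposition 1.2 BY NAME for the `levStd` torus family (as in every p08 torus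
file of C2 §2); constants existential per torus `P`, uniform in `k ≤ m + K`, in the truncation radius `R ≥ R₁`, in `χ₂`, `χ□` and in
`|c_∂| ≤ 1`.  (ii) `R` is a free parameter (print: `R = (1/2L)r(e_{k−1})`, and `e^{−cR}` is the printed `e^{−cr(e_k)}` since `r(e_{k−1}) ≥
r(e_k)`; the largeness of `r(e_k)` is the threshold `R ≥ R₁`).  (iii) **NOT treated: `w″₃ = w′₃ + Q^e_k∂^η(H_kΛ₂^{(k)*}□ − H_{k,loc}Λ₂^{(k)*})`**
(it needs the kernel of `Q^e_k∂^η` on the tori and the gradient member of (I.7.2.2) for `H_k`; p36's matrix instance covers it with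
displayed (2.6)/(2.7) and row-sum hypotheses) — so r16's `Ineq555`, which bundles both kernels, is NOT inhabited here (§3 is
bookkeeping only).  (iv) `U = 1` background as in p08's σ_k files, real abelian fields, torus, standing range, every `d ≥ 2`.  (v) No
`def`, no new named fact, nothing restated; NOT summit progress; NOT a claim about any continuum limit.  Unit `lit-balaban-p02`
(literature-prover-lit-balaban-p02-g8-0), 2026-08-21.
-/

open scoped BigOperators RealInnerProductSpace

namespace Literature.MathematicalPhysics.QuantumFieldTheory.BalabanImbrieJaffe1984to88.BIJ88Ineq555W3Torus

open Balaban1983to89 hiding Site Plaq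
open Balaban1983to89.LatticeFieldCalculus
open BIJ88Ineq217NearPart (pdist pdist_nonneg)
open BIJ85Prop521Torus BIJ85Sigma421Torus BIJ85Prop522Torus
open BIJ85Sect7Statements BIJ85Ineq722Torus
open BIJ85Ineq722ProofPart2 (settingOf)
open BIJ85Ineq722DeltaA (deltaAData)
open BIJ88Sect2Statements (Close trunc)
open BIJ88Sect5StatementsPart2 (Ineq555)
open BIJ88Decay216Prop12 (close218_torus_prop12)
open BIJ85Claim73ActualOne (sum_abs_curl_single_le)

open Balaban1983to89 renaming Site → TSite, Plaq → TPlaq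

noncomputable section

variable {P : Params}

/-! ## §1  The mechanism on rectangular carriers: (2.18)-closeness × a local column ⟹ (5.5.5) for `w′₃`; the range clause -/

section Mechanism

variable {α β : Type} [Fintype α]

/-- the `(p,b)` entry of `w′₃ = (σ_{k,loc} − σ_k)∂Λ₂□` (5.5.4), with `Λ₂ = χ₂`, `□ = χ□` contractions:
`w′₃(p,b) = (Σ_{p′}(σ_{k,loc} − σ_k)(p,p′)∂(p′,b))·χ₂(b)·χ□(b)` — notation fixed for this file (p36's `wPrime3_apply` shape).
[cite: BalabanImbrieJaffe1988, (5.5.4) p.284] -/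
theorem w3p_entry (σloc σ : α → α → ℝ) (D : α → β → ℝ) (χ₂ χb : β → ℝ) (p : α) (b : β) :
    (∑ p', (σloc p p' - σ p p') * D p' b) * χ₂ b * χb b =
      χ₂ b * χb b * ∑ p', (σloc p p' - σ p p') * D p' b := by
  ring

/-- **`|w′₃(p,b)| ≤ ε·S`** — the printed *"we have |w′₃(p,b)| ≦ e^{−cr(e_k)}"* reduced to (2.18): if `|σ_{k,loc}(p,p′) − σ_k(p,p′)| ≤
εe^{−δ dist(p,p′)}` (`Close dist σ_{k,loc} σ_k ε δ`, `0 ≤ δ`, `dist ≥ 0`), the column of the local operator `∂` at the bond `b` has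
`Σ_{p′}|∂(p′,b)| ≤ S`, and `|χ₂|, |χ□| ≤ 1`, then `|w′₃(p,b)| ≤ εS`. [cite: BalabanImbrieJaffe1988, (5.5.5) p.284] -/
theorem abs_w3p_le {dist : α → α → ℝ} (hdist : ∀ p p', 0 ≤ dist p p') {σloc σ : α → α → ℝ} {ε δ : ℝ}
    (hclose : Close dist σloc σ ε δ) (hδ : 0 ≤ δ) {D : α → β → ℝ} {S : ℝ} {b : β} (hD : ∑ p', |D p' b| ≤ S)
    {χ₂ χb : β → ℝ} (hχ₂ : |χ₂ b| ≤ 1) (hχb : |χb b| ≤ 1) (p : α) :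
    |(∑ p', (σloc p p' - σ p p') * D p' b) * χ₂ b * χb b| ≤ ε * S := by
  have hε : 0 ≤ ε := by
    have h := (abs_nonneg _).trans (hclose p p)
    have he : 0 < Real.exp (-δ * dist p p) := Real.exp_pos _
    nlinarith
  have hsum : |∑ p', (σloc p p' - σ p p') * D p' b| ≤ ε * S := by
    calc |∑ p', (σloc p p' - σ p p') * D p' b| ≤ ∑ p', |(σloc p p' - σ p p') * D p' b| :=
          Finset.abs_sum_le_sum_abs _ _
      _ ≤ ∑ p', ε * |D p' b| := by
          refine Finset.sum_le_sum fun p' _ => ?_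
          rw [abs_mul]
          refine mul_le_mul_of_nonneg_right ?_ (abs_nonneg _)
          refine (hclose p p').trans ?_
          have h1 : Real.exp (-δ * dist p p') ≤ 1 := by
            rw [Real.exp_le_one_iff]
            have := hdist p p'
            nlinarith
          nlinarith
      _ = ε * ∑ p', |D p' b| := by rw [Finset.mul_sum]
      _ ≤ ε * S := mul_le_mul_of_nonneg_left hD hε
  have hS : 0 ≤ ε * S := (abs_nonneg _).trans hsum
  calc |(∑ p', (σloc p p' - σ p p') * D p' b) * χ₂ b * χb b|
      = |∑ p', (σloc p p' - σ p p') * D p' b| * |χ₂ b| * |χb b| := by rw [abs_mul, abs_mul]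
    _ ≤ ε * S * 1 * 1 := by
        gcongr
    _ = ε * S := by ring

/-- **THE RANGE CLAUSE, mechanism**: `w′₃(p,b) = 0` wherever the cube factor vanishes, `χ□(b) = 0` — the kernel is supported in the
cube `□ = □(p)` of (5.5.4). [cite: BalabanImbrieJaffe1988, (5.5.5) p.284] -/
theorem w3p_eq_zero_of_box (σloc σ : α → α → ℝ) (D : α → β → ℝ) (χ₂ : β → ℝ) {χb : β → ℝ} {b : β} (hb : χb b = 0) (p : α) :
    (∑ p', (σloc p p' - σ p p') * D p' b) * χ₂ b * χb b = 0 := by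
  rw [hb, mul_zero]

/-- **THE RANGE CLAUSE** *"The kernels w′₃ … have range less than ½r(e_k)"*: if every cube `□(p)` lies within distance `ρ` of its
plaquette (`d(p,b) > ρ ⟹ χ□_p(b) = 0` — print: `□` a ½r(e_k)-cube *"centered near the plaquette that we are evaluating … at"*,
`ρ = ½r(e_k)`), then `w′₃(p,b) = 0` whenever `d(p,b) > ρ`, for ANY `σ_{k,loc}`, `σ_k`, `∂`, `Λ₂`. [cite: BalabanImbrieJaffe1988, (5.5.5) p.284] -/
theorem w3p_range {d : α → β → ℝ} {ρ : ℝ} {χb : α → β → ℝ} (hbox : ∀ p b, ρ < d p b → χb p b = 0)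
    (σloc σ : α → α → ℝ) (D : α → β → ℝ) (χ₂ : β → ℝ) {p : α} {b : β} (hfar : ρ < d p b) :
    (∑ p', (σloc p p' - σ p p') * D p' b) * χ₂ b * χb p b = 0 :=
  w3p_eq_zero_of_box σloc σ D χ₂ (hbox p b hfar) p

/-- the arithmetic of *"r(e_k) large"*: `A ≥ 0`, `γ > 0`, `A ≤ γR ⟹ A·e^{−2γR} ≤ e^{−γR}` (`1 + y ≤ e^y`). [folklore] -/
private theorem small_of_le_mul {A γ R : ℝ} (h : A ≤ γ * R) :
    A * Real.exp (-(2 * γ) * R) ≤ Real.exp (-(γ * R)) := by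
  have hA : A ≤ Real.exp (γ * R) :=
    h.trans ((le_add_of_nonneg_right zero_le_one).trans (by simpa [add_comm] using Real.add_one_le_exp (γ * R)))
  have hpos : 0 < Real.exp (-(2 * γ) * R) := Real.exp_pos _
  calc A * Real.exp (-(2 * γ) * R) ≤ Real.exp (γ * R) * Real.exp (-(2 * γ) * R) :=
        mul_le_mul_of_nonneg_right hA hpos.le
    _ = Real.exp (-(γ * R)) := by rw [← Real.exp_add]; congr 1; ring

end Mechanism

/-! ## §2  (5.5.5) for `w′₃` on the tori for the σ_k of record, given only [6I] Proposition 1.2 -/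

/-- **(5.5.5) FOR `w′₃` ON THE TORI, explicit form**: with the constants `(R₀, c₀, δ′)` of p08's (2.18) `close218_torus_prop12`, for
EVERY `k ≤ m + K`, every truncation radius `R ≥ R₀`, every curl factor `c_∂`, every `χ₂` with `|χ₂| ≤ 1` and every cube family with
`|χ□| ≤ 1`: `|w′₃(p,b)| ≤ c₀e^{−(δ′/2)R}·(4d|c_∂|)` — (2.18) on the tori × the column count of the unit curl at a bond (p33's
`sum_abs_curl_single_le`). [cite: BalabanImbrieJaffe1988, (5.5.5) p.284] -/
theorem ineq555_w3prime_torus_explicit (hd : 2 ≤ P.d) {a : ℝ} (ha : 0 < a)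
    (h12 : B5.Prop12Printed (fun i => settingOf (torusRep P (levStd P i) (deltaAData (levStd_le i) a)) i)) :
    ∃ R₀ c₀ δ' : ℝ, 0 < δ' ∧ 0 ≤ c₀ ∧ ∀ (k : ℕ) [DecidableEq (PBond P k)] (hk : k ≤ P.m + P.K) (R : ℝ), R₀ ≤ R →
      ∀ (cD : ℝ) (χ₂ : PBond P k → ℝ), (∀ b, |χ₂ b| ≤ 1) → ∀ (χb : TPlaq P k → PBond P k → ℝ), (∀ p b, |χb p b| ≤ 1) →
        ∀ (p : TPlaq P k) (b : PBond P k),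
          |(∑ p', (trunc pdist R (fun p q => sigmaTorus (P := P) hd ((P.eta k) ^ P.d) ((P.L : ℝ) ^ k) k (toU P k (Pi.single q 1)) p) p p'
                - sigmaTorus (P := P) hd ((P.eta k) ^ P.d) ((P.L : ℝ) ^ k) k (toU P k (Pi.single p' 1)) p) *
              curl cD (fun b' => if b' = b then (1 : ℝ) else 0) p') * χ₂ b * χb p b| ≤
            c₀ * Real.exp (-(δ' / 2) * R) * (4 * P.d * |cD|) := by
  obtain ⟨R₀, c₀, δ', hδ', hc₀, h218⟩ := close218_torus_prop12 hd ha h12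
  refine ⟨R₀, c₀, δ', hδ', hc₀, fun k _ hk R hR cD χ₂ hχ₂ χb hχb p b => ?_⟩
  exact abs_w3p_le (α := TPlaq P k) (β := PBond P k) (dist := pdist) (fun p p' => pdist_nonneg p p')
    (σloc := trunc pdist R fun p q => sigmaTorus (P := P) hd ((P.eta k) ^ P.d) ((P.L : ℝ) ^ k) k (toU P k (Pi.single q 1)) p)
    (σ := fun p q => sigmaTorus (P := P) hd ((P.eta k) ^ P.d) ((P.L : ℝ) ^ k) k (toU P k (Pi.single q 1)) p)
    (h218 k hk R hR) (by positivity)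
    (D := fun p' b => curl cD (fun b' => if b' = b then (1 : ℝ) else 0) p')
    (sum_abs_curl_single_le cD b) (hχ₂ b) (hχb p b) p

/-- **(5.5.5) FOR THE KERNEL `w′₃ = (σ_{k,loc} − σ_k)∂Λ₂^{(k)*}□` ON THE TORI OF THE SERIES, GIVEN ONLY [6I] PROPOSITION 1.2 BY ITS TREE
NAME**: there are `c > 0` and a threshold `R₁` such that for EVERY scale `k ≤ m + K`, every truncation radius `R ≥ R₁` of (2.14)
(print: `R = (1/2L)r(e_{k−1})`, large for `e_k` small), every unit-curl factor `|c_∂| ≤ 1` (print: `c_∂ = 1` on `T₁^{(k)}`), every region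
contraction `|χ₂| ≤ 1` (`Λ₂^{(k)*}`) and every cube family `|χ□| ≤ 1` (`□ = □(p)`), and all `p ∈ T₁^{(k)}`, `b`:
`|w′₃(p,b)| ≤ e^{−cR}` — the printed `|w′₃(p,b)| ≦ e^{−cr(e_k)}`; `σ_k = sigmaTorus hd η_k^d L^k k` (kernel of record),
`σ_{k,loc} = trunc pdist R σ_k`; `c = δ′/4`, `R₁ = max(R₀, 16d·c₀/δ′)` in the constants of p08's (2.18) `close218_torus_prop12`.
[cite: BalabanImbrieJaffe1988, (5.5.5) p.284] -/
theorem ineq555_w3prime_torus (hd : 2 ≤ P.d) {a : ℝ} (ha : 0 < a)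
    (h12 : B5.Prop12Printed (fun i => settingOf (torusRep P (levStd P i) (deltaAData (levStd_le i) a)) i)) :
    ∃ c R₁ : ℝ, 0 < c ∧ ∀ (k : ℕ) [DecidableEq (PBond P k)] (hk : k ≤ P.m + P.K) (R : ℝ), R₁ ≤ R →
      ∀ (cD : ℝ), |cD| ≤ 1 → ∀ (χ₂ : PBond P k → ℝ), (∀ b, |χ₂ b| ≤ 1) → ∀ (χb : TPlaq P k → PBond P k → ℝ), (∀ p b, |χb p b| ≤ 1) →
        ∀ (p : TPlaq P k) (b : PBond P k),
          |(∑ p', (trunc pdist R (fun p q => sigmaTorus (P := P) hd ((P.eta k) ^ P.d) ((P.L : ℝ) ^ k) k (toU P k (Pi.single q 1)) p) p p'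
                - sigmaTorus (P := P) hd ((P.eta k) ^ P.d) ((P.L : ℝ) ^ k) k (toU P k (Pi.single p' 1)) p) *
              curl cD (fun b' => if b' = b then (1 : ℝ) else 0) p') * χ₂ b * χb p b| ≤ Real.exp (-(c * R)) := by
  obtain ⟨R₀, c₀, δ', hδ', hc₀, h⟩ := ineq555_w3prime_torus_explicit hd ha h12
  have hd0 : (0 : ℝ) < P.d := by have := P.hd; exact_mod_cast (by omega : 0 < P.d)
  refine ⟨δ' / 4, max R₀ (16 * P.d * c₀ / δ'), by positivity, fun k _ hk R hR cD hcD χ₂ hχ₂ χb hχb p b => ?_⟩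
  have hR0 : R₀ ≤ R := (le_max_left _ _).trans hR
  have hR1 : 16 * P.d * c₀ / δ' ≤ R := (le_max_right _ _).trans hR
  refine (h k hk R hR0 cD χ₂ hχ₂ χb hχb p b).trans ?_
  -- c₀e^{−(δ′/2)R}·4d|c_∂| ≤ 4dc₀·e^{−(δ′/2)R} ≤ e^{−(δ′/4)R} once 4dc₀ ≤ (δ′/4)R
  have h1 : c₀ * Real.exp (-(δ' / 2) * R) * (4 * P.d * |cD|) ≤ (4 * P.d * c₀) * Real.exp (-(2 * (δ' / 4)) * R) := by
    have e : -(2 * (δ' / 4)) * R = -(δ' / 2) * R := by ring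
    rw [e]
    have hcD' : 4 * P.d * |cD| ≤ 4 * P.d * 1 := by gcongr
    have hexp : 0 < Real.exp (-(δ' / 2) * R) := Real.exp_pos _
    nlinarith [mul_nonneg hc₀ hexp.le]
  have hA : 4 * P.d * c₀ ≤ δ' / 4 * R := by
    rw [div_le_iff₀ hδ'] at hR1
    nlinarith
  exact h1.trans (small_of_le_mul hA)

/-- **THE RANGE CLAUSE ON THE TORI** (*"The kernels w′₃ … have range less than ½r(e_k)"*): for the torus kernel `w′₃` above — any scale,
radius, curl factor, `χ₂` — `w′₃(p,b) = 0` at every bond `b` outside the cube `□(p)` (`χ□_p(b) = 0`); with `□(p)` a ½r(e_k)-cube centred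
near `p` this is the printed range. [cite: BalabanImbrieJaffe1988, (5.5.5) p.284] -/
theorem w3p_range_torus (hd : 2 ≤ P.d) (k : ℕ) [DecidableEq (PBond P k)] (R cD : ℝ) (χ₂ : PBond P k → ℝ)
    {χb : TPlaq P k → PBond P k → ℝ} {p : TPlaq P k} {b : PBond P k} (hb : χb p b = 0) :
    (∑ p', (trunc pdist R (fun p q => sigmaTorus (P := P) hd ((P.eta k) ^ P.d) ((P.L : ℝ) ^ k) k (toU P k (Pi.single q 1)) p) p p'
          - sigmaTorus (P := P) hd ((P.eta k) ^ P.d) ((P.L : ℝ) ^ k) k (toU P k (Pi.single p' 1)) p) *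
        curl cD (fun b' => if b' = b then (1 : ℝ) else 0) p') * χ₂ b * χb p b = 0 := by
  rw [hb, mul_zero]

/-! ## §3  Bookkeeping: r16's typed pair statement from the two member bounds -/

/-- r16's typed (5.5.5) `Ineq555 Plaq Bond w′₃ w″₃ c r` (`|w′₃(p,b)|, |w″₃(p,b)| ≤ e^{−cr}` for all `p, b`) is exactly the conjunction
of the two member bounds; this file supplies the `w′₃` member on the tori (§2), the `w″₃` member is p36's matrix instance of record
(`BIJ88Ineq555Proof`) and is NOT re-proved here. [cite: BalabanImbrieJaffe1988, (5.5.5) p.284] -/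
theorem ineq555_of_members {Pl Bd : Type} {w₃' w₃'' : Pl → Bd → ℝ} {c rk : ℝ}
    (h' : ∀ p b, |w₃' p b| ≤ Real.exp (-(c * rk))) (h'' : ∀ p b, |w₃'' p b| ≤ Real.exp (-(c * rk))) :
    Ineq555 Pl Bd w₃' w₃'' c rk :=
  fun p b => ⟨h' p b, h'' p b⟩

end

end Literature.MathematicalPhysics.QuantumFieldTheory.BalabanImbrieJaffe1984to88.BIJ88Ineq555W3Torus
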